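import Mathlib
import Summits.NavierStokesRegularity.NavierStokesRegularity.Theorems.DssFarFieldSlavingBlowupTypeIDssProfileSimilarityEnstrophySpaceThreshold
import HarnessLib

/-!
# T47 CORE: the mixed constant, the intermediate-weight inequality, the stretching bound with the
  weight `1/‖y‖`, and the general closing step of the unweighted similarity-enstrophy budget
  (pub-ns-dss theory ENVELOPE-FLOOR.md v1.1 7d4ff1ae9522137b §3; lead A422 (b)/(4); route
  `DssFarFieldSlaving`, crux `BlowupTypeIDssProfile`, stmt-NavierStokesRegularity-0155 — SUPPORT,
  label-free kit shared by the Tier-1 and Tier-2 threshold files; typer seat g9, 2026-08-24)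

HONEST FRAMING. Analysis lemmas about a HYPOTHETICAL object (a Type-I ancient mild solution `V` in
the KNSS gauge, `IsTypeIAncientMild M V`) under the scale-invariant gauge bounds (D) of orders
`1, 2, 3`, phrased with the MIXED constant `P`: `‖x‖·√(−t)·‖V(t,x)‖² ≤ P` for all `t < 0`, `x` — in
similarity variables `‖y‖·‖U(s,y)‖² ≤ P` (`norm_mul_norm_lerayOrbit_sq_le`); `P ≤ θA` for time-only /
space-only constants `θ`, `A`; `P ≤ C₀²/4` under the envelope `HasTypeIDecay C₀ V` (AM–GM). CONTENT:
(i) the intermediate-weight inequality `∫‖Ω‖²/‖y‖ ≤ 2μ∫|∇Ω|²_F + (1/(2μ))∫‖Ω‖²` for every `μ > 0`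
(`integral_norm_sq_div_norm_le_of_hardy`) from the tree's vector HARDY inequality
`∫‖Ω‖²/‖y‖² ≤ 4∫|∇Ω|²_F` (`integral_norm_sq_div_norm_sq_le`) by pointwise Young — TIER 1 of the
theory note (the Coulomb uncertainty principle gives the factor `1` instead of `2`; not here);
(ii) the stretching bound with the weight, `Str ≤ (2/3)∫|∇Ω|²_F + (3P/8)∫‖Ω‖²/‖y‖`
(`integral_stretching_le_dissipation_add_mixedWeight`: IBP onto `U`, `div Ω = 0`, Young with
parameter `2/3`, `‖U‖² ≤ P/‖y‖` a.e.); (iii) the general closing step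
`typeI_ancient_eq_zero_of_stretching_le`: if `Str ≤ ∫|∇Ω|²_F + β·Z` on every slice with `β < ¼`
then `V ≡ 0` — the tree identity `½Z′ = −D − ¼Z + Str` (`similarityEnstrophy_hasDerivAt`) gives
`Z′ ≤ −(½ − 2β)Z` on `s ∈ ℝ` with `Z ≥ 0` bounded, then the backward ODE lemma
(`eq_zero_of_deriv_le_neg_mul`) and `Z ≡ 0 ⇒ V ≡ 0` (Row 2: `β = M_t²/4`; Row 5: `β = 0`; T47
Tier 1: `β = 27P²/64`; Tier 2: `β = 27P²/256`). METHOD constants; no sharpness claimed. The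
threshold / CLASS / portrait statements are in `…SimilarityEnstrophyMixedThreshold.lean`.
Derivation: theory seat (ENVELOPE-FLOOR.md §3, DERIVED — combination of printed steps; red ×2
requested 2026-08-24); typed on the Row 2 / Row 5 kit. Nothing is quoted from print; no census word
attaches to this file; nothing here bears on Navier–Stokes regularity or blow-up.
-/

noncomputable section

set_option linter.dupNamespace false

namespace Summit.NavierStokesRegularity.NavierStokesRegularity.Theorems.SimilarityEnstrophy

open MeasureTheory Set Filter Topology Module Metric InnerProductSpace Function
open scoped RealInnerProductSpace Laplacian ContDiff ENNReal
open Literature.Analysis Literature.Analysis.FluidPDE Literature.Analysis.Calculus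
open Summit.NavierStokesRegularity.NavierStokesRegularity.Theorems.GaussianGap
open Summit.NavierStokesRegularity.NavierStokesRegularity.Theorems.PlanarEnergyAPriori

variable {M : ℝ} {V : ℝ → EuclideanSpace ℝ (Fin 3) → EuclideanSpace ℝ (Fin 3)}

/-- The mixed constant is non-negative (evaluate the hypothesis at `x = 0`). [folklore] -/
theorem mixedConstant_nonneg {P : ℝ}
    (hP : ∀ t < 0, ∀ x, ‖x‖ * Real.sqrt (-t) * ‖V t x‖ ^ 2 ≤ P) : 0 ≤ P := by
  simpa using hP (-1) (by norm_num) 0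

/-- **The mixed constant in similarity variables**: `‖x‖·√(−t)·‖V(t,x)‖² ≤ P` for all `t < 0`, `x`
gives `‖y‖·‖U(s,y)‖² ≤ P` for the Leray orbit `U(s,y) = e^{−s/2} V(−e^{−s}, e^{−s/2}y)`
(`‖x‖ = e^{−s/2}‖y‖`, `√(−t) = e^{−s/2}`, `‖U‖² = e^{−s}‖V‖²`). [folklore] -/
theorem norm_mul_norm_lerayOrbit_sq_le {P : ℝ}
    (hP : ∀ t < 0, ∀ x, ‖x‖ * Real.sqrt (-t) * ‖V t x‖ ^ 2 ≤ P) (s : ℝ)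
    (y : EuclideanSpace ℝ (Fin 3)) : ‖y‖ * ‖lerayOrbit V s y‖ ^ 2 ≤ P := by
  have hpos : 0 < Real.exp (-s / 2) := Real.exp_pos _
  have ht : -Real.exp (-s) < 0 := neg_neg_of_pos (Real.exp_pos _)
  have key := hP _ ht (Real.exp (-s / 2) • y)
  rw [norm_smul, Real.norm_of_nonneg hpos.le, neg_neg, sqrt_exp_neg] at key
  rw [lerayOrbit_apply, norm_smul, Real.norm_of_nonneg hpos.le]
  calc ‖y‖ * (Real.exp (-s / 2) * ‖V (-Real.exp (-s)) (Real.exp (-s / 2) • y)‖) ^ 2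
      = Real.exp (-s / 2) * ‖y‖ * Real.exp (-s / 2) *
          ‖V (-Real.exp (-s)) (Real.exp (-s / 2) • y)‖ ^ 2 := by ring
    _ ≤ P := key

/-- **The envelope controls the mixed constant**: `‖V(t,x)‖ ≤ C₀/(‖x‖ + √(−t))` gives
`‖x‖·√(−t)·‖V(t,x)‖² ≤ C₀²/4` (AM–GM: `4ab ≤ (a+b)²`). [folklore] -/
theorem mixedConstant_le_of_hasTypeIDecay {C₀ : ℝ} (hdec : HasTypeIDecay C₀ V) :
    ∀ t < 0, ∀ x, ‖x‖ * Real.sqrt (-t) * ‖V t x‖ ^ 2 ≤ C₀ ^ 2 / 4 := by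
  intro t ht x
  have hb : 0 < Real.sqrt (-t) := Real.sqrt_pos.2 (neg_pos.2 ht)
  have hab : 0 < ‖x‖ + Real.sqrt (-t) := add_pos_of_nonneg_of_pos (norm_nonneg _) hb
  have h' : ‖V t x‖ * (‖x‖ + Real.sqrt (-t)) ≤ C₀ := (le_div_iff₀ hab).1 (hdec t ht x)
  have h0 : 0 ≤ ‖V t x‖ * (‖x‖ + Real.sqrt (-t)) := by positivity
  have h1 : (‖V t x‖ * (‖x‖ + Real.sqrt (-t))) ^ 2 ≤ C₀ ^ 2 := pow_le_pow_left₀ h0 h' 2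
  have h2 : (‖V t x‖ * (‖x‖ + Real.sqrt (-t))) ^ 2 - 4 * (‖x‖ * Real.sqrt (-t) * ‖V t x‖ ^ 2) =
      ‖V t x‖ ^ 2 * (‖x‖ - Real.sqrt (-t)) ^ 2 := by ring
  nlinarith [mul_nonneg (sq_nonneg ‖V t x‖) (sq_nonneg (‖x‖ - Real.sqrt (-t)))]

/-- **Two constants control the mixed constant**: `√(−t)‖V‖ ≤ θ` and `‖x‖‖V‖ ≤ A` give
`‖x‖·√(−t)·‖V‖² ≤ θA`. [folklore] -/
theorem mixedConstant_le_of_timeConstant_of_spaceConstant {θ A : ℝ}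
    (hθ : ∀ t < 0, ∀ x, Real.sqrt (-t) * ‖V t x‖ ≤ θ) (hA : ∀ t < 0, ∀ x, ‖x‖ * ‖V t x‖ ≤ A) :
    ∀ t < 0, ∀ x, ‖x‖ * Real.sqrt (-t) * ‖V t x‖ ^ 2 ≤ θ * A := by
  intro t ht x
  have h1 := hθ t ht x
  have h2 := hA t ht x
  have h1' : 0 ≤ Real.sqrt (-t) * ‖V t x‖ := by positivity
  have h2' : 0 ≤ ‖x‖ * ‖V t x‖ := by positivity
  calc ‖x‖ * Real.sqrt (-t) * ‖V t x‖ ^ 2 = (Real.sqrt (-t) * ‖V t x‖) * (‖x‖ * ‖V t x‖) := by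
        ring
    _ ≤ θ * A := mul_le_mul h1 h2 h2' (h1'.trans h1)

/-- **The intermediate weight from Hardy (Tier 1).** Under (D) at orders `1, 2` the function
`‖Ω(s,y)‖²/‖y‖` is integrable and, for every `μ > 0`,
`∫ ‖Ω‖²/‖y‖ ≤ 2μ ∫|∇Ω|²_F + (1/(2μ)) ∫‖Ω‖²`: pointwise Young
`b²/r ≤ (μ/2)·b²/r² + b²/(2μ)` and the vector Hardy inequality `∫‖Ω‖²/‖y‖² ≤ 4∫|∇Ω|²_F`
(`integral_norm_sq_div_norm_sq_le`). (The Coulomb uncertainty principle would give the constant `1`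
in place of `2`; not used.) [folklore] -/
theorem integral_norm_sq_div_norm_le_of_hardy (hV : IsTypeIAncientMild M V) {C₁ C₂ : ℝ}
    (hD1 : ∀ t < 0, ∀ x, (‖x‖ + Real.sqrt (-t)) ^ (1 + 1) * ‖iteratedFDeriv ℝ 1 (V t) x‖ ≤ C₁)
    (hD2 : ∀ t < 0, ∀ x, (‖x‖ + Real.sqrt (-t)) ^ (2 + 1) * ‖iteratedFDeriv ℝ 2 (V t) x‖ ≤ C₂)
    (s : ℝ) {μ : ℝ} (hμ : 0 < μ) :
    Integrable (fun y => ‖lerayVorticity V s y‖ ^ 2 / ‖y‖) ∧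
      ∫ y, ‖lerayVorticity V s y‖ ^ 2 / ‖y‖ ≤
        2 * μ * (∫ y, frobeniusNormSq (fderiv ℝ (lerayVorticity V s) y)) +
          1 / (2 * μ) * ∫ y, ‖lerayVorticity V s y‖ ^ 2 := by
  obtain ⟨hint, hHardy⟩ := integral_norm_sq_div_norm_sq_le hV hD1 hD2 s
  have iZ := integrable_norm_lerayVorticity_sq hV hD1 s
  have hΩ := contDiff_lerayVorticity_slice hV s
  -- pointwise Young (holds at `y = 0` as well, where the left side is `0` by convention)
  have hpt : ∀ y : EuclideanSpace ℝ (Fin 3), ‖lerayVorticity V s y‖ ^ 2 / ‖y‖ ≤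
      μ / 2 * (‖lerayVorticity V s y‖ ^ 2 / ‖y‖ ^ 2) +
        1 / (2 * μ) * ‖lerayVorticity V s y‖ ^ 2 := by
    intro y
    rcases eq_or_ne y 0 with rfl | hy
    · simp only [norm_zero, div_zero, ne_eq, OfNat.ofNat_ne_zero, not_false_eq_true, zero_pow,
        mul_zero, zero_add]
      positivity
    · have hr : 0 < ‖y‖ := norm_pos_iff.2 hy
      set b2 := ‖lerayVorticity V s y‖ ^ 2 with hb2
      have hb0 : 0 ≤ b2 := sq_nonneg _
      have e : μ / 2 * (b2 / ‖y‖ ^ 2) + 1 / (2 * μ) * b2 - b2 / ‖y‖ =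
          b2 * (μ - ‖y‖) ^ 2 / (2 * μ * ‖y‖ ^ 2) := by
        field_simp
        ring
      have hnn : 0 ≤ b2 * (μ - ‖y‖) ^ 2 / (2 * μ * ‖y‖ ^ 2) := by positivity
      linarith
  have imaj : Integrable fun y => μ / 2 * (‖lerayVorticity V s y‖ ^ 2 / ‖y‖ ^ 2) +
      1 / (2 * μ) * ‖lerayVorticity V s y‖ ^ 2 := (hint.const_mul _).add (iZ.const_mul _)
  have hmeas : AEStronglyMeasurable (fun y => ‖lerayVorticity V s y‖ ^ 2 / ‖y‖) volume :=
    ((hΩ.continuous.norm.pow 2).measurable.div continuous_norm.measurable).aestronglyMeasurable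
  have hX : Integrable (fun y => ‖lerayVorticity V s y‖ ^ 2 / ‖y‖) := by
    refine imaj.mono' hmeas (Eventually.of_forall fun y => ?_)
    rw [Real.norm_of_nonneg (by positivity)]
    exact hpt y
  refine ⟨hX, ?_⟩
  have hF0 : 0 ≤ ∫ y, frobeniusNormSq (fderiv ℝ (lerayVorticity V s) y) :=
    integral_nonneg fun y => frobeniusNormSq_nonneg _
  calc ∫ y, ‖lerayVorticity V s y‖ ^ 2 / ‖y‖
      ≤ ∫ y, (μ / 2 * (‖lerayVorticity V s y‖ ^ 2 / ‖y‖ ^ 2) +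
          1 / (2 * μ) * ‖lerayVorticity V s y‖ ^ 2) := integral_mono hX imaj hpt
    _ = μ / 2 * (∫ y, ‖lerayVorticity V s y‖ ^ 2 / ‖y‖ ^ 2) +
          1 / (2 * μ) * ∫ y, ‖lerayVorticity V s y‖ ^ 2 := by
        rw [integral_add (hint.const_mul _) (iZ.const_mul _), integral_const_mul,
          integral_const_mul]
    _ ≤ μ / 2 * (4 * ∫ y, frobeniusNormSq (fderiv ℝ (lerayVorticity V s) y)) +
          1 / (2 * μ) * ∫ y, ‖lerayVorticity V s y‖ ^ 2 := by
        gcongr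
    _ = 2 * μ * (∫ y, frobeniusNormSq (fderiv ℝ (lerayVorticity V s) y)) +
          1 / (2 * μ) * ∫ y, ‖lerayVorticity V s y‖ ^ 2 := by ring

/-- **The stretching bound with the intermediate weight** (theory ENVELOPE-FLOOR §3 (3.1)):
`Str(s) = ∫⟪Ω, DU Ω⟫ ≤ (2/3)∫|∇Ω(s)|²_F + (3P/8)∫‖Ω(s)‖²/‖y‖` for a KNSS-gauge Type-I field with
mixed constant `P` (`‖y‖‖U(s,y)‖² ≤ P`) under (D) at `k = 1, 2`: move the derivative onto `Ω`
(`∫Ωᵀ(∇U)Ω = −∫U·((Ω·∇)Ω)`, `div Ω = 0`) and bound pointwise (a.e., `y ≠ 0`)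
`|U·((Ω·∇)Ω)| ≤ ‖U‖‖DΩ‖_op‖Ω‖ ≤ (2/3)|DΩ|²_F + (3/8)‖U‖²‖Ω‖² ≤ (2/3)|DΩ|²_F + (3P/8)‖Ω‖²/‖y‖`
(Young with parameter `2/3`, the optimal constant split of the theory note). The weight integral is
then bounded by Hardy here (Tier 1) — or by the Coulomb uncertainty principle (Tier 2, not in this
file). [this file; theory T47] -/
theorem integral_stretching_le_dissipation_add_mixedWeight (hV : IsTypeIAncientMild M V)
    {C₁ C₂ : ℝ}
    (hD1 : ∀ t < 0, ∀ x, (‖x‖ + Real.sqrt (-t)) ^ (1 + 1) * ‖iteratedFDeriv ℝ 1 (V t) x‖ ≤ C₁)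
    (hD2 : ∀ t < 0, ∀ x, (‖x‖ + Real.sqrt (-t)) ^ (2 + 1) * ‖iteratedFDeriv ℝ 2 (V t) x‖ ≤ C₂)
    {P : ℝ} (hP : ∀ t < 0, ∀ x, ‖x‖ * Real.sqrt (-t) * ‖V t x‖ ^ 2 ≤ P) (s : ℝ) :
    ∫ y, ⟪lerayVorticity V s y, fderiv ℝ (lerayOrbit V s) y (lerayVorticity V s y)⟫ ≤
      2 / 3 * (∫ y, frobeniusNormSq (fderiv ℝ (lerayVorticity V s) y)) +
        3 * P / 8 * ∫ y, ‖lerayVorticity V s y‖ ^ 2 / ‖y‖ := by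
  have hΩ := contDiff_lerayVorticity_slice hV s
  have hU : ContDiff ℝ ∞ (lerayOrbit V s) := contDiff_lerayOrbit_slice_of_typeI hV s le_rfl
  have hdiv : VectorCalculus.IsDivFree (lerayVorticity V s) := fun y =>
    divergence_curl_eq_zero_holds _ (hU.of_le (by norm_cast)) y
  have iZ := integrable_norm_lerayVorticity_sq hV hD1 s
  have iF := integrable_frobeniusNormSq_fderiv_lerayVorticity hV hD2 s
  have iS := integrable_inner_stretching_lerayVorticity hV hD1 s
  have iT := integrable_inner_lerayOrbit_convect_lerayVorticity hV hD1 hD2 s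
  have hP0 : 0 ≤ P := mixedConstant_nonneg hP
  have hUP : ∀ y, ‖y‖ * ‖lerayOrbit V s y‖ ^ 2 ≤ P := norm_mul_norm_lerayOrbit_sq_le hP s
  -- integration by parts: `Str = −∫⟪U, (Ω·∇)Ω⟫`
  have iS' : Integrable fun y =>
      ⟪convect (lerayVorticity V s) (lerayOrbit V s) y, lerayVorticity V s y⟫ := by
    refine iS.congr (Eventually.of_forall fun y => ?_)
    simp only [convect_apply]
    exact real_inner_comm _ _
  have hIBP := integral_inner_convect_eq_neg_integral_inner_convect_self hΩ hU hdiv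
    (fun y => norm_lerayOrbit_le_of_typeI hV s y) iZ iS' iT
  have hStr : ∫ y, ⟪lerayVorticity V s y, fderiv ℝ (lerayOrbit V s) y (lerayVorticity V s y)⟫ =
      -∫ y, ⟪lerayOrbit V s y, convect (lerayVorticity V s) (lerayVorticity V s) y⟫ := by
    rw [← hIBP]
    refine integral_congr_ae (Eventually.of_forall fun y => ?_)
    simp only [convect_apply]
    exact real_inner_comm _ _
  rw [hStr, ← integral_neg]
  -- notation for the two integrals on the right
  set D : ℝ := ∫ y, frobeniusNormSq (fderiv ℝ (lerayVorticity V s) y) with hD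
  set X : ℝ := ∫ y, ‖lerayVorticity V s y‖ ^ 2 / ‖y‖ with hX
  obtain ⟨hXint, -⟩ := integral_norm_sq_div_norm_le_of_hardy hV hD1 hD2 s one_pos
  -- pointwise Young with parameter `2/3`, a.e. (`y ≠ 0`)
  have hy0 : ∀ᵐ y ∂(volume : Measure (EuclideanSpace ℝ (Fin 3))), y ≠ 0 := by
    have : (volume : Measure (EuclideanSpace ℝ (Fin 3))) {0} = 0 := measure_singleton 0
    refine ae_iff.2 ?_
    simp only [ne_eq, not_not, setOf_eq_eq_singleton]
    exact this
  have hae : ∀ᵐ y ∂volume,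
      -⟪lerayOrbit V s y, convect (lerayVorticity V s) (lerayVorticity V s) y⟫ ≤
        2 / 3 * frobeniusNormSq (fderiv ℝ (lerayVorticity V s) y) +
          3 * P / 8 * (‖lerayVorticity V s y‖ ^ 2 / ‖y‖) := by
    filter_upwards [hy0] with y hy
    have hypos : 0 < ‖y‖ := norm_pos_iff.2 hy
    set a := ‖fderiv ℝ (lerayVorticity V s) y‖ with ha
    set b := ‖lerayVorticity V s y‖ with hb
    set u := ‖lerayOrbit V s y‖ with hu
    have ha0 : 0 ≤ a := norm_nonneg _
    have hb0 : 0 ≤ b := norm_nonneg _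
    have hu0 : 0 ≤ u := norm_nonneg _
    have hop := sq_opNorm_le_frobeniusNormSq (fderiv ℝ (lerayVorticity V s) y)
    have h1 : -⟪lerayOrbit V s y, convect (lerayVorticity V s) (lerayVorticity V s) y⟫ ≤
        u * (a * b) := by
      calc -⟪lerayOrbit V s y, convect (lerayVorticity V s) (lerayVorticity V s) y⟫
          ≤ ‖⟪lerayOrbit V s y, convect (lerayVorticity V s) (lerayVorticity V s) y⟫‖ := by
            rw [Real.norm_eq_abs]; exact neg_le_abs _
        _ ≤ ‖lerayOrbit V s y‖ * ‖convect (lerayVorticity V s) (lerayVorticity V s) y‖ :=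
            norm_inner_le_norm _ _
        _ ≤ u * (a * b) := by
            rw [convect_apply]
            exact mul_le_mul_of_nonneg_left (ContinuousLinearMap.le_opNorm _ _) hu0
    have h2 : u * (a * b) ≤ 2 / 3 * a ^ 2 + 3 / 8 * (u ^ 2 * b ^ 2) := by
      nlinarith [sq_nonneg (a - 3 / 4 * (u * b))]
    have h3 : u ^ 2 * b ^ 2 ≤ P * (b ^ 2 / ‖y‖) := by
      have hu2 : u ^ 2 ≤ P / ‖y‖ := by
        rw [le_div_iff₀ hypos, mul_comm]; exact hUP y
      calc u ^ 2 * b ^ 2 ≤ P / ‖y‖ * b ^ 2 := mul_le_mul_of_nonneg_right hu2 (sq_nonneg _)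
        _ = P * (b ^ 2 / ‖y‖) := by ring
    have h4 : 2 / 3 * a ^ 2 ≤ 2 / 3 * frobeniusNormSq (fderiv ℝ (lerayVorticity V s) y) :=
      mul_le_mul_of_nonneg_left hop (by norm_num)
    nlinarith
  have hint1 : ∫ y, -⟪lerayOrbit V s y, convect (lerayVorticity V s) (lerayVorticity V s) y⟫ ≤
      2 / 3 * D + 3 * P / 8 * X := by
    calc ∫ y, -⟪lerayOrbit V s y, convect (lerayVorticity V s) (lerayVorticity V s) y⟫
        ≤ ∫ y, (2 / 3 * frobeniusNormSq (fderiv ℝ (lerayVorticity V s) y) +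
            3 * P / 8 * (‖lerayVorticity V s y‖ ^ 2 / ‖y‖)) :=
          integral_mono_ae iT.neg ((iF.const_mul _).add (hXint.const_mul _)) hae
      _ = 2 / 3 * D + 3 * P / 8 * X := by
          rw [integral_add (iF.const_mul _) (hXint.const_mul _), integral_const_mul,
            integral_const_mul]
  exact hint1

/-- **The unweighted similarity-enstrophy budget closes whenever the stretching is absorbed with a
`Z`-coefficient below `¼`** (the common closing step of Rows 2 / 5 / T47): a KNSS-gauge Type-I field
with the gauge bounds (D) of orders `1, 2, 3` and `Str(s) ≤ ∫|∇Ω(s)|²_F + β·Z(s)` for every `s`,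
with `β < ¼`, vanishes on `t < 0` — `½Z' = −D − ¼Z + Str` (`similarityEnstrophy_hasDerivAt`) gives
`Z' ≤ −(½ − 2β)Z`; `Z ≥ 0` is bounded on `ℝ` by (D₁), so `Z ≡ 0` (`eq_zero_of_deriv_le_neg_mul`),
and `Z ≡ 0 ⇒ V ≡ 0` (`eq_zero_of_integral_norm_lerayVorticity_sq_eq_zero`). [folklore; this file] -/
theorem typeI_ancient_eq_zero_of_stretching_le (hV : IsTypeIAncientMild M V) {C₁ C₂ C₃ : ℝ}
    (hD1 : ∀ t < 0, ∀ x, (‖x‖ + Real.sqrt (-t)) ^ (1 + 1) * ‖iteratedFDeriv ℝ 1 (V t) x‖ ≤ C₁)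
    (hD2 : ∀ t < 0, ∀ x, (‖x‖ + Real.sqrt (-t)) ^ (2 + 1) * ‖iteratedFDeriv ℝ 2 (V t) x‖ ≤ C₂)
    (hD3 : ∀ t < 0, ∀ x, (‖x‖ + Real.sqrt (-t)) ^ (3 + 1) * ‖iteratedFDeriv ℝ 3 (V t) x‖ ≤ C₃)
    {β : ℝ} (hβ : β < 1 / 4)
    (hStr : ∀ s, ∫ y, ⟪lerayVorticity V s y, fderiv ℝ (lerayOrbit V s) y (lerayVorticity V s y)⟫ ≤
      (∫ y, frobeniusNormSq (fderiv ℝ (lerayVorticity V s) y)) +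
        β * ∫ y, ‖lerayVorticity V s y‖ ^ 2) :
    ∀ t < 0, ∀ x, V t x = 0 := by
  set Z : ℝ → ℝ := fun σ => ∫ y, ‖lerayVorticity V σ y‖ ^ 2 with hZ
  have hZd := fun σ => similarityEnstrophy_hasDerivAt hV hD1 hD2 hD3 σ
  have hdiff : Differentiable ℝ Z := fun σ => (hZd σ).differentiableAt
  have hZ0 : ∀ σ, 0 ≤ Z σ := fun σ => integral_nonneg fun y => by positivity
  -- `Z` bounded, from (D₁)
  have hc₀ := decayConst_nonneg hD1
  have hcont : Continuous fun y : EuclideanSpace ℝ (Fin 3) =>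
      (‖curlCLM‖ * C₁) ^ 2 * (1 + ‖y‖) ^ (-(4 : ℝ)) :=
    continuous_const.mul ((continuous_const.add continuous_norm).rpow_const
      fun y => Or.inl (add_pos_of_pos_of_nonneg one_pos (norm_nonneg y)).ne')
  have imaj : Integrable fun y : EuclideanSpace ℝ (Fin 3) =>
      (‖curlCLM‖ * C₁) ^ 2 * (1 + ‖y‖) ^ (-(4 : ℝ)) :=
    integrable_of_le_decay_four hcont (K := (‖curlCLM‖ * C₁) ^ 2) fun y => by
      rw [Real.norm_of_nonneg (by positivity)]
  have hbdd : ∃ B, ∀ σ, Z σ ≤ B := by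
    refine ⟨∫ y : EuclideanSpace ℝ (Fin 3), (‖curlCLM‖ * C₁) ^ 2 * (1 + ‖y‖) ^ (-(4 : ℝ)),
      fun σ => ?_⟩
    refine integral_mono (integrable_norm_lerayVorticity_sq hV hD1 σ) imaj fun y => ?_
    have h := norm_lerayVorticity_le_decay hV hD1 σ y
    calc ‖lerayVorticity V σ y‖ ^ 2 ≤ (‖curlCLM‖ * C₁ * (1 + ‖y‖) ^ (-(2 : ℝ))) ^ 2 :=
          pow_le_pow_left₀ (norm_nonneg _) h 2
      _ = (‖curlCLM‖ * C₁) ^ 2 * ((1 + ‖y‖) ^ (-(2 : ℝ)) * (1 + ‖y‖) ^ (-(2 : ℝ))) := by ring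
      _ = (‖curlCLM‖ * C₁) ^ 2 * (1 + ‖y‖) ^ (-(4 : ℝ)) := by
          rw [SlabLaw.rpow_neg_mul_rpow_neg]; norm_num
  -- `Z' ≤ −κ Z`, `κ = ½ − 2β > 0`
  have hκ : 0 < 1 / 2 - 2 * β := by linarith
  have hZ' : ∀ σ, deriv Z σ ≤ -(1 / 2 - 2 * β) * Z σ := by
    intro σ
    rw [(hZd σ).deriv]
    have hS := hStr σ
    have hZσ : Z σ = ∫ y, ‖lerayVorticity V σ y‖ ^ 2 := rfl
    rw [hZσ]
    linarith
  have hZzero := eq_zero_of_deriv_le_neg_mul hdiff hZ0 hbdd hκ hZ'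
  exact eq_zero_of_integral_norm_lerayVorticity_sq_eq_zero hV hD1 hZzero

end Summit.NavierStokesRegularity.NavierStokesRegularity.Theorems.SimilarityEnstrophy
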